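import Literature.NumberTheory.EllipticCurves.Greenberg1999.ControlLocalKernelsLayerTwoTorsionProofs
import Summits.BirchSwinnertonDyer.BirchSwinnertonDyer.Theorems.ByReductionTypeAtTwoMultTowerLocalAddvPotGood
import Literature.NumberTheory.EllipticCurves.KodairaNeronUnramifiedInertiaProofs
import Mathlib.NumberTheory.Padics.HeightOneSpectrum
import HarnessLib

/-!
# Route `ByReductionTypeAtTwo`, TOWER road (items stmt-BirchSwinnertonDyer-19922 `MultUpperHalfAtTwo` and 19271
# `OrdKatoHalfAtTwo`): ZERO BITS at an odd ADDITIVE prime with NO `ℚ_ℓ`-rational `2`-torsion — the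
# type-free lever (`E(ℚ_ℓ)[2] = 0 ⟹ 𝒦_{v,n}[2^∞] = 0` at every layer), its mod-`ℓᵏ` CERTIFICATE, and the
# per-place dispatcher with this SEVENTH disjunct

HONEST FRAMING (cell `bsd-2adic`, run/shared/lean/pub/bsd-2adic/, seat `bsd-2adic-tower-1` GEN 12, HUMAN RULINGS
D-0036 / D-0054 / D-0074 (T1)): THEOREMS ONLY — no definition, no new named fact; nothing is booked; BSD is not proved
by any of this. PARTITION: X5@2 TOWER rows (mult 19922 and good-ordinary 19271) × p = 2 — types-the-object-of (the
per-prime local constant `C_ℓ` of every tower-gap certificate at an odd additive prime); closes none.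

WHAT. The tower doors price an odd additive prime `ℓ` by the `2`-torsion of Greenberg's local tower kernel
`𝒦_{v,n}[2^∞]` (LNM 1716, §3 Lemma 3.3, p. 88: `|ker r_v| = c_v^{(p)}`): two bits in general, zero bits at Kodaira
types II/IV/IV*/II* (mult-2 GEN 8, `…MultTowerLocalAddv`, via the GEOMETRIC component group), one bit at III/III*
(`…LocalAddvPotGood`) and at `ord_ℓ Δ_min` odd (mult-2 GEN 10, `…LocalAddvOddOrd`). The Literature theorem
`Greenberg1999.finite_and_natCard_localTowerKerPrimary_le_one_of_additive_of_twoTorsion` (this seat, file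
`Greenberg1999/ControlLocalKernelsLayerTwoTorsionProofs`) gives the EXACT rational criterion for zero bits:
**at an additive `v ∤ 2`, if `E(K_v)` has no point of order `2` then `𝒦_{v,n}[2^∞] = 0` at every layer of every
`ℤ₂`-extension** (the layer's Galois group has `2`-power index, and a `2`-torsion point fixed by a `2`-power-index
subgroup forces a `K_v`-rational one). This re-derives the II/IV/IV*/II* cases WITHOUT Kodaira symbols and is NEW
at type I₀* with Tamagawa number `c_ℓ = 1` (the `2`-division cubic is irreducible over `ℚ_ℓ`: Frobenius is a
`3`-cycle on `E[2]`, never rational in the `2`-tower), where the blanket price was two bits per place.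
* §1 `pTorsion_le_one_of_additive_of_noTwoTorsion` — the counted currency `#𝒦_{v,n}[2^∞][2] ≤ 1` (any number field).
* §2 the ℚ-CERTIFICATE `noTwoTorsion_of_cubic_cert`: if the `2`-division cubic `4x³ + b₂x² + 2b₄x + b₆` (integer
  `bᵢ`) has no root in `ℤ/ℓᵏ` (decidable) then `E(ℚ_ℓ)` has no point of order `2` (a `Γ_{ℚ_ℓ}`-fixed `2`-torsion
  point of `E(ℚ̄_ℓ)` has `x ∈ ℚ_ℓ` a root, `ℓ`-adically integral since the leading coefficient `4` is a unit,
  reducing to a root mod `ℓᵏ` along Mathlib's `ℚ_v ≃ ℚ_ℓ`); `pTorsion_le_one_of_cert_noTwoTorsion` — with the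
  additivity certificate `ℓ ∣ c₄`, `ℓ ∣ Δ_min` (tree `hasAdditiveReductionAt_of_dvd_of_dvd`).
* §3 the dispatcher `pTorsion_localTowerKer_le_of_numeric_addvZ` = mult-2's six-disjunct
  `MultTowerAddv.pTorsion_localTowerKer_le_of_numeric_addv2` + the SEVENTH disjunct
  `(additive ∧ no ℚ_v-rational 2-torsion ∧ 1 ≤ C)`.
CENSUS (seat script, HOME/STATUS 2026-08-27T18:35Z): on the `E[2]`-irreducible multiplicative habitat 30 of the 51 I₀*
prime-instances are certified rootless at `k = 4`; 29 of the 402 classes left after mult-2 GEN 10 carry one; 9 of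
them have layer-3 deficit ≤ the saving.

References: R. Greenberg, LNM 1716 (1999), §3 Lemma 3.3 (pp. 86–88); J. H. Silverman, *AEC* (2009) III.§2 / Ex. 3.7,
VIII.§1, VII.5.1; mult-2's `…MultTowerLocalAddv{,PotGood}` for the sibling disjuncts.
-/

set_option autoImplicit false
-- the Theorems namespace of this sub repeats the summit name by design (D-0017 nested layout: Summit.<S>.<Sub>)
set_option linter.dupNamespace false

noncomputable section

open scoped Classical

open NumberField IsDedekindDomain WeierstrassCurve Polynomial Literature.NumberTheory.EllipticCurves
  Literature.NumberTheory.EllipticCurves.Greenberg1999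
  Literature.NumberTheory.GaloisRepresentations
  IsDedekindDomain.HeightOneSpectrum Rat.HeightOneSpectrum

namespace Summit.BirchSwinnertonDyer.BirchSwinnertonDyer.Theorems.TowerAddvZ

universe u

/-! ## §1 The counted currency: `#𝒦_{v,n}[2^∞][2] ≤ 1` (any number field, any `ℤ₂`-extension) -/

section Local

variable {K : Type u} [Field K] [NumberField K] (W : WeierstrassCurve K) {v : HeightOneSpectrum (𝓞 K)}
  (κ : ZpExtension K 2)

/-- **`#𝒦_{v,n}[2^∞][2] ≤ 1` at an additive `v ∤ 2` where `E(K_v)` has no point of order `2`** — the `2`-torsion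
classes of the trivial group `𝒦_{v,n}[2^∞]` (Literature theorem
`finite_and_natCard_localTowerKerPrimary_le_one_of_additive_of_twoTorsion`), in the currency the tower doors consume.
[cite: GreenbergLNM1716, §3 Lemma 3.3 (proof, PDF p. 88)] -/
theorem pTorsion_le_one_of_additive_of_noTwoTorsion [W.IsElliptic]
    (h2v : ((2 : ℕ) : 𝓞 K) ∉ v.asIdeal) (hadd : W.HasAdditiveReductionAt v)
    (h2 : ∀ P : localPoints W (v.adicCompletion K),
      (∀ σ : Field.absoluteGaloisGroup (v.adicCompletion K), σ • P = P) → 2 • P = 0 → P = 0) (n : ℕ) :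
    Finite {x : W.localTowerKerPrimary κ (v.adicCompletion K) n // 2 • x = 0} ∧
      Nat.card {x : W.localTowerKerPrimary κ (v.adicCompletion K) n // 2 • x = 0} ≤ 1 := by
  obtain ⟨hfin, hle⟩ :=
    finite_and_natCard_localTowerKerPrimary_le_one_of_additive_of_twoTorsion W κ h2v hadd h2 n
  haveI := hfin
  exact ⟨Finite.of_injective _ Subtype.val_injective,
    (Nat.card_le_card_of_injective _ Subtype.val_injective).trans hle⟩

end Local

/-! ## §2 The certificate over `ℚ`: no `ℚ_ℓ`-rational `2`-torsion from «no root of the `2`-division cubic mod `ℓᵏ`» -/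

section Cert

/-- **An `ℓ`-adic root of an integer cubic with leading coefficient `4` is integral (`ℓ` odd).** If `z ∈ ℚ_ℓ`,
`ℓ ≠ 2`, satisfies `4z³ + B₂z² + 2B₄z + B₆ = 0` with `B₂, B₄, B₆ ∈ ℤ`, then `‖z‖ ≤ 1`: otherwise `‖4z³‖ = ‖z‖³`
exceeds `‖B₂z² + 2B₄z + B₆‖ ≤ ‖z‖²` (ultrametric inequality). [folklore] -/
theorem padicNorm_le_one_of_cubic_root {p : ℕ} [Fact p.Prime] (hp2 : p ≠ 2) {B₂ B₄ B₆ : ℤ}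
    {z : ℚ_[p]} (hz : 4 * z ^ 3 + (B₂ : ℚ_[p]) * z ^ 2 + 2 * (B₄ : ℚ_[p]) * z + (B₆ : ℚ_[p]) = 0) :
    ‖z‖ ≤ 1 := by
  by_contra h
  rw [not_le] at h
  have h4 : ‖(4 : ℚ_[p])‖ = 1 := by
    rw [show (4 : ℚ_[p]) = ((4 : ℕ) : ℚ_[p]) by norm_num, Padic.norm_natCast_eq_one_iff]
    rw [show (4 : ℕ) = 2 ^ 2 by norm_num]
    exact (Nat.coprime_primes (Fact.out) Nat.prime_two |>.mpr hp2).pow_right 2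
  have hA : ‖4 * z ^ 3‖ = ‖z‖ ^ 3 := by rw [norm_mul, norm_pow, h4, one_mul]
  have hz0 : 0 < ‖z‖ := lt_trans zero_lt_one h
  have hB₂ : ‖(B₂ : ℚ_[p]) * z ^ 2‖ ≤ ‖z‖ ^ 2 := by
    rw [norm_mul, norm_pow]
    exact mul_le_of_le_one_left (pow_nonneg (norm_nonneg _) 2) (Padic.norm_int_le_one B₂)
  have hB₄ : ‖2 * (B₄ : ℚ_[p]) * z‖ ≤ ‖z‖ ^ 2 := by
    rw [norm_mul, norm_mul, show (2 : ℚ_[p]) = ((2 : ℤ) : ℚ_[p]) by norm_num]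
    calc ‖((2 : ℤ) : ℚ_[p])‖ * ‖(B₄ : ℚ_[p])‖ * ‖z‖ ≤ 1 * 1 * ‖z‖ := by
          gcongr
          · exact Padic.norm_int_le_one 2
          · exact Padic.norm_int_le_one B₄
      _ = ‖z‖ := by ring
      _ ≤ ‖z‖ ^ 2 := by nlinarith
  have hB₆ : ‖(B₆ : ℚ_[p])‖ ≤ ‖z‖ ^ 2 :=
    (Padic.norm_int_le_one B₆).trans (by nlinarith)
  have hR : ‖(B₂ : ℚ_[p]) * z ^ 2 + 2 * (B₄ : ℚ_[p]) * z + (B₆ : ℚ_[p])‖ ≤ ‖z‖ ^ 2 := by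
    refine (Padic.nonarchimedean _ _).trans (max_le ?_ hB₆)
    exact (Padic.nonarchimedean _ _).trans (max_le hB₂ hB₄)
  have heq : 4 * z ^ 3 = -((B₂ : ℚ_[p]) * z ^ 2 + 2 * (B₄ : ℚ_[p]) * z + (B₆ : ℚ_[p])) := by
    linear_combination hz
  rw [heq, norm_neg] at hA
  have h32 : ‖z‖ ^ 3 ≤ ‖z‖ ^ 2 := hA ▸ hR
  have hlt : ‖z‖ ^ 2 * 1 < ‖z‖ ^ 2 * ‖z‖ := mul_lt_mul_of_pos_left h (pow_pos hz0 2)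
  rw [mul_one, ← pow_succ] at hlt
  exact absurd h32 (not_le.mpr hlt)

set_option maxHeartbeats 800000 in
/-- **No `ℚ_ℓ`-rational `2`-torsion from a mod-`ℓᵏ` certificate.** Let `W/ℚ` have integer invariants `b₂ = B₂`,
`b₄ = B₄`, `b₆ = B₆`, let `v` be the place over an odd prime `ℓ`, and suppose the `2`-division cubic
`4x³ + B₂x² + 2B₄x + B₆` has NO root in `ℤ/ℓᵏ` (decidable). Then `E(ℚ_ℓ)` has no point of order `2`, in the
`Γ_{ℚ_ℓ}`-module form the tower lemmas consume: every `Γ_{ℚ_ℓ}`-fixed `P ∈ E(ℚ̄_ℓ)` with `2P = O` is `O`. Proof: a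
fixed `P = (x, y)` has `x ∈ ℚ_v` (Galois descent: `ℚ̄_v/ℚ_v` is Galois) and `x` is a root of the cubic (Silverman
III.§2, Ex. 3.7; tree `isRoot_twoTorsionPolynomial_of_add_self_eq_zero`); along Mathlib's `ℚ_v ≃ₐ ℚ_ℓ`
(`Rat.HeightOneSpectrum.adicCompletion.padicEquiv`) the root is `ℓ`-adically integral
(`padicNorm_le_one_of_cubic_root`) and reduces to a root in `ℤ/ℓᵏ` (`PadicInt.toZModPow`).
[cite: SilvermanAEC2009, III.§2 and Ex. 3.7; VIII.§1] -/
theorem noTwoTorsion_of_cubic_cert (W : WeierstrassCurve ℚ) (v : HeightOneSpectrum (𝓞 ℚ)) {ℓ : ℕ}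
    [Fact ℓ.Prime] (hv : (primesEquiv v : ℕ) = ℓ) (hℓ2 : ℓ ≠ 2)
    {B₂ B₄ B₆ : ℤ} (hb : W.b₂ = B₂ ∧ W.b₄ = B₄ ∧ W.b₆ = B₆) {k : ℕ}
    (hcert : ∀ x : ZMod (ℓ ^ k),
      4 * x ^ 3 + (B₂ : ZMod (ℓ ^ k)) * x ^ 2 + 2 * (B₄ : ZMod (ℓ ^ k)) * x + (B₆ : ZMod (ℓ ^ k)) ≠ 0) :
    ∀ P : localPoints W (v.adicCompletion ℚ),
      (∀ σ : Field.absoluteGaloisGroup (v.adicCompletion ℚ), σ • P = P) → 2 • P = 0 → P = 0 := by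
  subst hv
  intro P hfix h2P
  haveI := isGalois_algebraicClosure_adicCompletion (v := v)
  change (W.baseChange (AlgebraicClosure (v.adicCompletion ℚ))).toAffine.Point at P
  rcases P with _ | ⟨x, y, hxy⟩
  · rfl
  · exfalso
    -- the coordinates are `Γ`-fixed, hence in `ℚ_v`
    have hx : ∀ σ : AlgebraicClosure (v.adicCompletion ℚ) ≃ₐ[v.adicCompletion ℚ]
        AlgebraicClosure (v.adicCompletion ℚ), σ x = x := by
      intro σ
      have h := hfix σ
      rw [localPoints.smul_def, Affine.Point.map_some] at h
      exact (Affine.Point.some.inj h).1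
    obtain ⟨x₀, hx₀⟩ := (InfiniteGalois.mem_range_algebraMap_iff_fixed x).mpr hx
    -- `x` is a root of the `2`-division cubic
    have h2P' : Affine.Point.some x y hxy + Affine.Point.some x y hxy = 0 := by
      rw [← two_nsmul]; exact h2P
    have hroot := ((W.baseChange (AlgebraicClosure (v.adicCompletion ℚ))).isRoot_twoTorsionPolynomial_of_add_self_eq_zero h2P').2
    simp only [WeierstrassCurve.twoTorsionPolynomial, Cubic.toPoly, IsRoot.def, eval_add, eval_mul,
      eval_C, eval_pow, eval_X, eval_intCast, WeierstrassCurve.baseChange, WeierstrassCurve.map_b₂,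
      WeierstrassCurve.map_b₄, WeierstrassCurve.map_b₆, hb.1, hb.2.1, hb.2.2, map_intCast] at hroot
    -- in `ℚ_v`
    have hroot₀ : 4 * x₀ ^ 3 + (B₂ : v.adicCompletion ℚ) * x₀ ^ 2 + 2 * (B₄ : v.adicCompletion ℚ) * x₀ +
        (B₆ : v.adicCompletion ℚ) = 0 := by
      apply (algebraMap (v.adicCompletion ℚ) (AlgebraicClosure (v.adicCompletion ℚ))).injective
      rw [map_zero, ← hroot]
      simp only [map_add, map_mul, map_pow, map_intCast, map_ofNat, hx₀]
    -- in `ℚ_ℓ`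
    set e := adicCompletion.padicEquiv v with he
    set z : ℚ_[(primesEquiv v : ℕ)] := e x₀ with hzdef
    have hz : 4 * z ^ 3 + (B₂ : ℚ_[(primesEquiv v : ℕ)]) * z ^ 2 + 2 * (B₄ : ℚ_[(primesEquiv v : ℕ)]) * z +
        (B₆ : ℚ_[(primesEquiv v : ℕ)]) = 0 := by
      have h := congrArg e hroot₀
      simpa only [map_add, map_mul, map_pow, map_intCast, map_ofNat, map_zero] using h
    have hz1 : ‖z‖ ≤ 1 := padicNorm_le_one_of_cubic_root hℓ2 hz
    -- in `ℤ_ℓ`, then in `ℤ/ℓᵏ`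
    set zi : ℤ_[(primesEquiv v : ℕ)] := ⟨z, hz1⟩ with hzi
    have hzi0 : 4 * zi ^ 3 + (B₂ : ℤ_[(primesEquiv v : ℕ)]) * zi ^ 2 + 2 * (B₄ : ℤ_[(primesEquiv v : ℕ)]) * zi +
        (B₆ : ℤ_[(primesEquiv v : ℕ)]) = 0 := by
      apply PadicInt.ext
      push_cast
      exact hz
    have hred := congrArg (PadicInt.toZModPow k) hzi0
    simp only [map_add, map_mul, map_pow, map_intCast, map_ofNat, map_zero] at hred
    exact hcert _ hred

variable (W : WeierstrassCurve ℚ) [W.IsElliptic] [W.IsGloballyMinimal]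

/-- **The per-place certificate in counted currency.** For a globally minimal `W/ℚ`, any `ℤ₂`-extension `κ`, the place
`v` over an odd prime `ℓ` with `ℓ ∣ Δ_min` and `ℓ ∣ c₄` (additive reduction, Silverman VII.5.1(c); tree
`hasAdditiveReductionAt_of_dvd_of_dvd`) and a mod-`ℓᵏ` certificate that the `2`-division cubic (integer invariants
`bᵢ = Bᵢ`) has no root: `#𝒦_{v,n}[2^∞][2] ≤ 1` at every layer `n` — ZERO bits at `ℓ`.
[cite: GreenbergLNM1716, §3 Lemma 3.3 (proof, PDF p. 88)] [cite: SilvermanAEC2009, VII.5 Prop. 5.1(c); III.§2 Ex. 3.7] -/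
theorem pTorsion_le_one_of_cert_noTwoTorsion (κ : ZpExtension ℚ 2) (v : HeightOneSpectrum (𝓞 ℚ)) {ℓ : ℕ}
    [Fact ℓ.Prime] (hv : (primesEquiv v : ℕ) = ℓ) (hℓ2 : ℓ ≠ 2)
    (hΔ : (ℓ : ℤ) ∣ W.minimalDiscriminantInt) (hc₄ : (ℓ : ℤ) ∣ (integralModelInt W).c₄)
    {B₂ B₄ B₆ : ℤ} (hb : W.b₂ = B₂ ∧ W.b₄ = B₄ ∧ W.b₆ = B₆) {k : ℕ}
    (hcert : ∀ x : ZMod (ℓ ^ k),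
      4 * x ^ 3 + (B₂ : ZMod (ℓ ^ k)) * x ^ 2 + 2 * (B₄ : ZMod (ℓ ^ k)) * x + (B₆ : ZMod (ℓ ^ k)) ≠ 0) (n : ℕ) :
    Finite {x : W.localTowerKerPrimary κ (v.adicCompletion ℚ) n // 2 • x = 0} ∧
      Nat.card {x : W.localTowerKerPrimary κ (v.adicCompletion ℚ) n // 2 • x = 0} ≤ 1 := by
  have hadd : W.HasAdditiveReductionAt v :=
    W.hasAdditiveReductionAt_of_dvd_of_dvd v (by rw [hv]; exact hΔ) (by rw [hv]; exact hc₄)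
  have h2v : ((2 : ℕ) : 𝓞 ℚ) ∉ v.asIdeal := by
    rw [KatoHalfPinch.natCast_prime_mem_asIdeal_iff v Nat.prime_two]
    change natGenerator v ≠ 2
    rw [show natGenerator v = ℓ from hv]; exact hℓ2
  exact pTorsion_le_one_of_additive_of_noTwoTorsion W κ h2v hadd (noTwoTorsion_of_cubic_cert W v hv hℓ2 hb hcert) n

end Cert

/-! ## §3 The per-place dispatcher with the SEVENTH (rational-2-torsion-free additive) disjunct -/

section Dispatch

variable (W : WeierstrassCurve ℚ) [W.IsElliptic]

/-- **The local constant at an odd place, seven disjuncts.** For `W/ℚ` elliptic, `κ` cyclotomic at `2`, an odd place `v`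
and a layer `n`: `#𝒦_{v,n}[2] ≤ C` as soon as ONE of: `4 ≤ C`; multiplicative and `2 ≤ C`; multiplicative with
`2 ∤ ord_v(Δ_min)` and `1 ≤ C`; good and `1 ≤ C`; additive with `2 ∤ c̄_v` and `1 ≤ C`; additive of type `≠ I_m*`
and `2 ≤ C` (all six = mult-2's `MultTowerAddv.pTorsion_localTowerKer_le_of_numeric_addv2`); **additive with NO
`ℚ_v`-rational `2`-torsion and `1 ≤ C`** (this file). [cite: GreenbergLNM1716, §3 Lemma 3.3 (PDF pp. 86–88)]
[cite: SilvermanAEC2009, III.§2 Ex. 3.7] -/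
theorem pTorsion_localTowerKer_le_of_numeric_addvZ
    (h33g : lemma33_localTowerKerPrimary_eq_bot_of_good.{0})
    (hM : lemma33_localTowerKerPrimary_cyclic_of_multiplicative.{0})
    (hA : lemma33_natCard_localTowerKerPrimary_le_four_of_additive.{0})
    (κ : ZpExtension ℚ 2) (hκ : κ.IsCyclotomic) (v : HeightOneSpectrum (𝓞 ℚ))
    (h2v : ((2 : ℕ) : 𝓞 ℚ) ∉ v.asIdeal) (n C : ℕ)
    (hC : 4 ≤ C ∨ (W.HasMultiplicativeReductionAt v ∧ 2 ≤ C) ∨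
      (W.HasMultiplicativeReductionAt v ∧ ¬ 2 ∣ W.ordMinimalDiscriminant v ∧ 1 ≤ C) ∨
      (W.HasGoodReductionAt v ∧ 1 ≤ C) ∨
      (W.HasAdditiveReductionAt v ∧ ¬ 2 ∣ (W.kodairaSymbolAt v).componentGroupOrder ∧ 1 ≤ C) ∨
      (W.HasAdditiveReductionAt v ∧ (∀ m, W.kodairaSymbolAt v ≠ .Istar m) ∧ 2 ≤ C) ∨
      (W.HasAdditiveReductionAt v ∧
        (∀ P : localPoints W (v.adicCompletion ℚ),
          (∀ σ : Field.absoluteGaloisGroup (v.adicCompletion ℚ), σ • P = P) → 2 • P = 0 → P = 0) ∧ 1 ≤ C)) :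
    Finite {x : W.localTowerKerPrimary κ (v.adicCompletion ℚ) n // 2 • x = 0} ∧
      Nat.card {x : W.localTowerKerPrimary κ (v.adicCompletion ℚ) n // 2 • x = 0} ≤ C := by
  haveI : Fact (Nat.Prime 2) := ⟨Nat.prime_two⟩
  rcases hC with h | h | h | h | h | h | ⟨hadd, h2, h1⟩
  · exact MultTowerAddv.pTorsion_localTowerKer_le_of_numeric_addv2 W h33g hM hA κ hκ v h2v n C (Or.inl h)
  · exact MultTowerAddv.pTorsion_localTowerKer_le_of_numeric_addv2 W h33g hM hA κ hκ v h2v n C (Or.inr (Or.inl h))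
  · exact MultTowerAddv.pTorsion_localTowerKer_le_of_numeric_addv2 W h33g hM hA κ hκ v h2v n C
      (Or.inr (Or.inr (Or.inl h)))
  · exact MultTowerAddv.pTorsion_localTowerKer_le_of_numeric_addv2 W h33g hM hA κ hκ v h2v n C
      (Or.inr (Or.inr (Or.inr (Or.inl h))))
  · exact MultTowerAddv.pTorsion_localTowerKer_le_of_numeric_addv2 W h33g hM hA κ hκ v h2v n C
      (Or.inr (Or.inr (Or.inr (Or.inr (Or.inl h)))))
  · exact MultTowerAddv.pTorsion_localTowerKer_le_of_numeric_addv2 W h33g hM hA κ hκ v h2v n C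
      (Or.inr (Or.inr (Or.inr (Or.inr (Or.inr h)))))
  · obtain ⟨hf, hle⟩ := pTorsion_le_one_of_additive_of_noTwoTorsion W κ h2v hadd h2 n
    exact ⟨hf, hle.trans h1⟩

end Dispatch

end Summit.BirchSwinnertonDyer.BirchSwinnertonDyer.Theorems.TowerAddvZ

end
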